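import Literature.Analysis.FluidPDE.HolderHalfDirectionCriterion
import HarnessLib

/-!
# CriticalCoherenceDoorGronwallExponent — door S33 «CriticalCoherenceDoor», plate G33 tool: the singular part
# `∫₀ᵗ a/(T − s) ds = a·log(T/(T − t))` of the Grönwall exponent, as a lower Lebesgue integral

S-door lane (LEAD ns-s30-p1 g2; planner of record nsreg-p1, PLATE-AID-33 §G33), seat nsreg-C26-p1 g5,
`--supports stmt-NavierStokesRegularity-0056 --as helper`.  One calculus lemma used by
`Theorems/CriticalCoherenceDoorGronwall.lean` (`powerGronwallSlab_holds`); no Navier–Stokes content.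
WHAT THIS IS NOT: nothing about S33 itself; item 0056 `NoTypeII` and NS regularity are NOT proved.
-/

noncomputable section

open MeasureTheory Set Function Filter Metric Real
open _root_.Topology
open scoped ENNReal NNReal

set_option linter.dupNamespace false

namespace Summit.NavierStokesRegularity.NavierStokesRegularity.Theorems.CriticalCoherenceDoor

/-- The singular part of the exponent: for `0 < t ≤ T'' < T` and `a` real,
`∫⁻_{]0,t[} ofReal (a / max(T − s, T − T'')) ds = ofReal (a · log (T/(T − t)))` when `0 ≤ a`
(fundamental theorem of calculus for `s ↦ −a log (T − s)` on `[0, t]`, where `max(T − s, T − T'') = T − s`).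
[folklore] -/
theorem lintegral_div_max_sub_eq {T T'' a t : ℝ} (hT''T : T'' < T) (ha : 0 ≤ a) (ht0 : 0 < t)
    (htT'' : t ≤ T'') :
    ∫⁻ s in Ioo 0 t, ENNReal.ofReal (a / max (T - s) (T - T'')) =
      ENNReal.ofReal (a * Real.log (T / (T - t))) := by
  have hTT'' : 0 < T - T'' := by linarith
  have hT : 0 < T := by linarith
  have hTt : 0 < T - t := by linarith
  have hdpos : ∀ s : ℝ, 0 < max (T - s) (T - T'') := fun s => lt_max_of_lt_right hTT''
  have hdcont : Continuous fun s : ℝ => max (T - s) (T - T'') :=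
    (continuous_const.sub continuous_id).max continuous_const
  have hgcont : Continuous fun s : ℝ => a / max (T - s) (T - T'') :=
    continuous_const.div hdcont fun s => (hdpos s).ne'
  have hg0 : ∀ s : ℝ, 0 ≤ a / max (T - s) (T - T'') := fun s => div_nonneg ha (hdpos s).le
  have hgi : IntegrableOn (fun s : ℝ => a / max (T - s) (T - T'')) (Ioo 0 t) :=
    (hgcont.integrableOn_Icc (a := 0) (b := t)).mono_set Ioo_subset_Icc_self
  rw [← ofReal_integral_eq_lintegral_ofReal hgi (Eventually.of_forall fun s => hg0 s)]
  congr 1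
  rw [← integral_Ioc_eq_integral_Ioo, ← intervalIntegral.integral_of_le ht0.le]
  have hderiv : ∀ s ∈ uIcc 0 t,
      HasDerivAt (fun s : ℝ => -a * Real.log (T - s)) (a / max (T - s) (T - T'')) s := by
    intro s hs
    rw [uIcc_of_le ht0.le] at hs
    have hTs : 0 < T - s := by linarith [hs.2]
    have hds : max (T - s) (T - T'') = T - s := max_eq_left (by linarith [hs.2])
    rw [hds]
    have h1 : HasDerivAt (fun s : ℝ => T - s) (-1) s := (hasDerivAt_id' s).const_sub T
    have h2 : HasDerivAt (fun s : ℝ => Real.log (T - s)) (-1 / (T - s)) s := h1.log hTs.ne'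
    have h3 := h2.const_mul (-a)
    refine h3.congr_deriv ?_
    field_simp
  rw [intervalIntegral.integral_eq_sub_of_hasDerivAt hderiv (hgcont.intervalIntegrable _ _)]
  rw [sub_zero, Real.log_div hT.ne' hTt.ne']
  ring

end Summit.NavierStokesRegularity.NavierStokesRegularity.Theorems.CriticalCoherenceDoor

end
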